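import Mathlib
import Literature.MathematicalPhysics.QuantumLattice.WilsonDiracAP
import Summits.QuantumFields.QCD.Theorems.QuarksAsStableActionCriticalLineDiamagnetismStubGaugeCoercive

/-!
# The cell Wilson form is coercive modulo gauge on the `2⁴` block, for `N` colours
(helper for crux stmt-QuantumFields-9307 `FlatCellOptimal`, line `registered`, stub
`stub_hessianMarginAllN`, sub-goal `stub_gaugeCoerciveAllN` — the `Fin 3 ↦ Fin N` port of the sibling
crux stmt-QuantumFields-9734's `…CriticalLineDiamagnetismStubGaugeCoercive`, gap G2a, wave 3)

What.  On the `2⁴` block (sites `TorusSite 4 2 = Fin 4 → ZMod 2`, `64` links) let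
`Y : Edge 4 2 → M_N(ℂ)` (any colour number `N : ℕ`) be linkwise anti-Hermitian and TILING-ODD,
`Y (x + μ̂, μ) = -Y (x, μ)`.  The cell Wilson form is
`𝒦(Y) = Σ_{x, i<j} ‖Y(x,i) + Y(x+î,j) - Y(x+ĵ,i) - Y(x,j)‖_F²`.  We prove
(`stub_gaugeCoerciveAllN`): there is an anti-Hermitian site function `λ : TorusSite 4 2 → M_N(ℂ)`
with `8 · Σ_e ‖Y e - (λ(e.1) - λ(e.1 + ê.2))‖_F² ≤ 𝒦(Y)` — verbatim the sibling's
`stub_gaugeCoercive` with `Fin 3 ↦ Fin N`; the constant `8` is `N`-free.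

How.  The argument is colour-ENTRYWISE, so nothing depends on `N`: the real scalar core
(`GaugeCoercive.core` of the sibling file — Walsh–Fourier analysis on `(ℤ/2)⁴` with the sixteen real
characters `χ_s(x) = Π_μ sgn(s_μ x_μ)`, Plancherel, the shift rule, and sixteen elementary
`4`-vector inequalities) gives, for every tiling-odd REAL link field `g` and the gauge generator
`L(x) = Σ_s (χ_s(x) / (32 n_s)) Σ_μ Σ_y χ_s(y) g(y,μ)`,
`8 Σ_e (g e - (L(e.1) - L(e.1 + ê.2)))² ≤ Σ_p (curl g)_p²`.  That lemma and the Walsh toolkit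
(`chi_symm`, `chi_mul_self`, `chi_shift`, `chi_shift_left`, `sum_chi_mul`, `sum_chi_mul_right`,
`plancherel`, `transform_shift`, `sum_pairs`, `per_class`, `core`, and the signs `sgn_mul_self`,
`sgn_mul_sgn_of_ne`) do not mention the colour index; they are imported and re-EXPORTED into this
namespace (aliases, no restatement), so that `open GaugeCoercive` downstream sees the same names as
at `N = 3`.  New here is only the entrywise reduction for a GENERAL finite colour index
(`sum_frob_eq_re_im`, `sum_frob_le_of_re_im`, any `Fintype` row/column types in place of `Fin 3`):
a Frobenius inequality `8 Σ_i ‖M_i‖_F² ≤ Σ_k ‖N_k‖_F²` follows from the corresponding inequalities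
for the real and the imaginary part of each entry `(a, b)`.  The generator
`λ(x) = Σ_s (χ_s(x)/(32 n_s)) Σ_μ Σ_y χ_s(y) Y(y,μ)` has real coefficients, hence is anti-Hermitian
with `Y`, and its `(a, b)` entry's real/imaginary part is the scalar generator of the real/imaginary
part of the `(a, b)` entry of `Y`.
Sources: folklore (discrete Hodge/Walsh decomposition on the hypercube).  Pure theorem file; the
characters `χ` and the generator are variables with defining hypotheses, instantiated by `rfl`.
-/

noncomputable section

open scoped BigOperators Classical Matrix ComplexConjugate
open Finset
open Literature.MathematicalPhysics.QuantumLattice Literature.MathematicalPhysics.QuantumFieldTheory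
  Literature.Probability.LatticeModels

namespace Summit.QuantumFields.QCD.Cruxes.FlatCellOptimal.GaugeCoercive

/-! ### Colour-free lemmas of the sibling file, re-exported

The Walsh–Fourier toolkit on `(ℤ/2)⁴` and the real scalar core do not mention the colour index; they
are the sibling's declarations, aliased into this namespace. -/

export Summit.QuantumFields.QCD.Cruxes.CriticalLineDiamagnetism.ChessboardCellGain.GaugeCoercive
  (sgn_mul_self sgn_mul_sgn_of_ne chi_symm chi_mul_self chi_shift chi_shift_left sum_chi_mul
    sum_chi_mul_right plancherel transform_shift sum_pairs per_class core)

/-! ### Entrywise reduction for a general finite colour index -/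

/-- The Frobenius sum of squares of a family of complex matrices (any finite row and column index
types), split entrywise into real and imaginary parts. -/
theorem sum_frob_eq_re_im {ι α β : Type*} [Fintype ι] [Fintype α] [Fintype β]
    (P : ι → Matrix α β ℂ) :
    ∑ i, ∑ a, ∑ b, ‖P i a b‖ ^ 2 =
      ∑ a, ∑ b, (∑ i, (P i a b).re ^ 2 + ∑ i, (P i a b).im ^ 2) := by
  calc _ = ∑ a, ∑ i, ∑ b, ‖P i a b‖ ^ 2 := Finset.sum_comm
    _ = _ := by
        refine Finset.sum_congr rfl fun a _ => ?_
        calc _ = ∑ b, ∑ i, ‖P i a b‖ ^ 2 := Finset.sum_comm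
          _ = _ := by
              refine Finset.sum_congr rfl fun b _ => ?_
              rw [← Finset.sum_add_distrib]
              refine Finset.sum_congr rfl fun i _ => ?_
              rw [Complex.sq_norm, Complex.normSq_apply]
              ring

/-- Entrywise reduction: a Frobenius-norm inequality between two families of complex matrices (any
finite row and column index types) follows from the corresponding inequalities for the real and
imaginary parts of each entry. -/
theorem sum_frob_le_of_re_im {ι κ α β : Type*} [Fintype ι] [Fintype κ] [Fintype α] [Fintype β]
    (M : ι → Matrix α β ℂ) (N : κ → Matrix α β ℂ)
    (hre : ∀ a b, 8 * ∑ i, (M i a b).re ^ 2 ≤ ∑ k, (N k a b).re ^ 2)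
    (him : ∀ a b, 8 * ∑ i, (M i a b).im ^ 2 ≤ ∑ k, (N k a b).im ^ 2) :
    8 * ∑ i, ∑ a, ∑ b, ‖M i a b‖ ^ 2 ≤ ∑ k, ∑ a, ∑ b, ‖N k a b‖ ^ 2 := by
  rw [sum_frob_eq_re_im M, sum_frob_eq_re_im N, Finset.mul_sum]
  refine Finset.sum_le_sum fun a _ => ?_
  rw [Finset.mul_sum]
  refine Finset.sum_le_sum fun b _ => ?_
  rw [mul_add]
  exact add_le_add (hre a b) (him a b)

/-- **Gauge coercivity for `N` colours** (the cell Wilson form is coercive modulo gauge; finite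
Fourier analysis on `(ℤ/2)⁴`), with the colour number as an implicit variable.  For a tiling-odd
anti-Hermitian block link field `Y : Edge 4 2 → M_N(ℂ)` there is an anti-Hermitian gauge generator
`λ` with `8·‖Y − dλ‖² ≤ 𝒦(Y) = Σ_p ‖curl Y_p‖²_F`.  The generator is
`λ(x) = Σ_s (χ_s(x) / (32 n_s)) Σ_μ Σ_y χ_s(y) Y(y,μ)`; the inequality is the sibling's real scalar
`core` applied to the real and imaginary parts of every colour entry (`sum_frob_le_of_re_im`). -/
theorem gaugeCoercive {N : ℕ} (Y : Edge 4 2 → Matrix (Fin N) (Fin N) ℂ) (hY : ∀ e, (Y e)ᴴ = -Y e)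
    (hodd : ∀ (x : TorusSite 4 2) (μ : Fin 4), Y (Site.shift x μ, μ) = -Y (x, μ)) :
    ∃ lam : TorusSite 4 2 → Matrix (Fin N) (Fin N) ℂ, (∀ x, (lam x)ᴴ = -lam x) ∧
      8 * (∑ e : Edge 4 2, ∑ a, ∑ b, ‖(Y e - (lam e.1 - lam (Site.shift e.1 e.2))) a b‖ ^ 2) ≤
        (∑ p : Plaquette 4 2, ∑ a, ∑ b, ‖(Y (p.1, p.2.1.1) + Y (Site.shift p.1 p.2.1.1, p.2.1.2) -
          Y (Site.shift p.1 p.2.1.2, p.2.1.1) - Y (p.1, p.2.1.2)) a b‖ ^ 2) := by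
  obtain ⟨χ, hχ⟩ : ∃ χ : TorusSite 4 2 → TorusSite 4 2 → ℝ,
      ∀ s x, χ s x = ∏ μ, if s μ * x μ = 0 then (1 : ℝ) else -1 := ⟨_, fun _ _ => rfl⟩
  obtain ⟨lam, hlam⟩ : ∃ lam : TorusSite 4 2 → Matrix (Fin N) (Fin N) ℂ, ∀ x, lam x =
      ∑ s, ((χ s x / (32 * ∑ ν, if s ν = 0 then (0 : ℝ) else 1) : ℝ) : ℂ) •
        ∑ μ : Fin 4, ∑ y, ((χ s y : ℝ) : ℂ) • Y (y, μ) := ⟨_, fun _ => rfl⟩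
  refine ⟨lam, fun x => ?_, ?_⟩
  · simp only [hlam, Matrix.conjTranspose_sum, Matrix.conjTranspose_smul, Complex.star_def,
      Complex.conj_ofReal, hY, smul_neg, Finset.sum_neg_distrib]
  · refine sum_frob_le_of_re_im _ _ (fun a b => ?_) (fun a b => ?_)
    · have key := core χ hχ (fun e => (Y e a b).re)
        (fun x μ => by simp [hodd]) (fun x => (lam x a b).re) (fun x => by
          simp only [hlam, Matrix.sum_apply, Matrix.smul_apply, smul_eq_mul, Complex.re_sum,
            Complex.re_ofReal_mul])
      simpa only [Matrix.sub_apply, Matrix.add_apply, Complex.sub_re, Complex.add_re] using key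
    · have key := core χ hχ (fun e => (Y e a b).im)
        (fun x μ => by simp [hodd]) (fun x => (lam x a b).im) (fun x => by
          simp only [hlam, Matrix.sum_apply, Matrix.smul_apply, smul_eq_mul, Complex.im_sum,
            Complex.im_ofReal_mul])
      simpa only [Matrix.sub_apply, Matrix.add_apply, Complex.sub_im, Complex.add_im] using key

/-- **Registered sub-goal of this file** (`stub_gaugeCoerciveAllN`, stub MgK of the sibling crux for
every colour number `N`): for a tiling-odd anti-Hermitian block link field `Y : Edge 4 2 → M_N(ℂ)`
there is an anti-Hermitian gauge generator `λ` with `8·‖Y − dλ‖² ≤ 𝒦(Y)`. -/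
theorem stub_gaugeCoerciveAllN : ∀ (N : ℕ) (Y : Edge 4 2 → Matrix (Fin N) (Fin N) ℂ), (∀ e, (Y e)ᴴ = -Y e) → (∀ (x : TorusSite 4 2) (μ : Fin 4), Y (Site.shift x μ, μ) = -Y (x, μ)) → ∃ lam : TorusSite 4 2 → Matrix (Fin N) (Fin N) ℂ, (∀ x, (lam x)ᴴ = -lam x) ∧ 8 * (∑ e : Edge 4 2, ∑ a, ∑ b, ‖(Y e - (lam e.1 - lam (Site.shift e.1 e.2))) a b‖ ^ 2) ≤ (∑ p : Plaquette 4 2, ∑ a, ∑ b, ‖(Y (p.1, p.2.1.1) + Y (Site.shift p.1 p.2.1.1, p.2.1.2) - Y (Site.shift p.1 p.2.1.2, p.2.1.1) - Y (p.1, p.2.1.2)) a b‖ ^ 2) :=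
  fun _ => gaugeCoercive

end Summit.QuantumFields.QCD.Cruxes.FlatCellOptimal.GaugeCoercive

end
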